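import Literature.NumberTheory.EllipticCurves.ShaCorestrictionIndexTwo
import Literature.NumberTheory.EllipticCurves.SubgroupSelmerProofs
import Summits.BirchSwinnertonDyer.Rank1Residual.Additive.LocalSubgroupTransport
import HarnessLib

/-!
# Route `GenusKolyvaginAtTwo` — corestriction maps `Ш(E_K/K)` into `Ш(E/ℚ)`, I: change of embedding and the
# transport of a local vanishing for the model pair `(rangeToResGal, θ⁻¹)` (coefficients `E(K̄)`)

Seat `bsd-line-gk2-p4` g28 (cell `bsd-f1-sign2`), WIDTH-5 attach on route `GenusKolyvaginAtTwo` rev 57; helper of the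
K₄/K₄⁺ consistency law (one-bit law) of gk2-p4 g27 — `…ShaCardDvdPowAtTwoPosTDefectOneBitLaw{,Exact,Kernel}` carry the
DISPLAYED binders `hcorE : ∀ c ∈ Ш(E_K/K), corBaseChange … c ∈ Ш(E/ℚ)` / `hcorT` («the local double-coset
compatibility of corestriction — PRINT»), and `Literature/…/ShaCorestrictionIndexTwo.lean` flags «NOT HERE (by design):
cor maps Ш(E_K/K) into Ш(E/ℚ) for a GENERAL E».  This file and its sequel `…ShaCorestrictionLocalTriviality` PROVE IT.
THIS FILE = the generic Galois-cohomology bookkeeping with `E(K̄)`-coefficients (the tree's t42/b2b Selmer transport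
`LocalSubgroupTransport` / `…AdditiveSelmerBaseChangeTransport` is typed for `E[p^∞]`): for ANY base field `F`, ANY
algebraic `L/F`, `W/F`:

* §1 `resH1Hom_resGalSubgroupOfEmb_comp(_eq_zero_iff)` — changing the embedding `F̄ → Ē` by `τ ∈ Γ_F` conjugates the local
  restriction `H¹(H, E(F̄)) → H¹(H_ι, E(Ē))` (twin of `WeierstrassCurve.localResOverOfEmb_comp_apply`);
* §2 `transportPoints_pointsMapOfEmb_localPointsEquivGeomPoints` — the coefficient identity `(ι₂⁻¹)_* ∘ ι'_* ∘ θ = ι_*`,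
  `θ = localPointsEquivGeomPoints ∘ pointsMap : E(F̄) ≃ E_L(L̄)` (twin of `transportPoints_pointsMapOfEmb`);
* §3 `resH1Hom_model_eq_zero_of_transport` — along `(ι : F̄ → Ē, ι₂ : Ē ≃ Ē', ι' : L̄ → Ē')` with `ι' ∘ ι_L = ι₂ ∘ ι` and
  `hfix`: if `x ∈ H¹(L, E_L)` dies at `ι'`, then its model class `res_{(rangeToResGal, ψ)} x ∈ H¹(galRange L, E(F̄))`
  (`ψ ∘ θ = id`; for `F = ℚ` this is `galH1Model`) dies under the local restriction attached to `ι` on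
  `H_ι = (res_ι)⁻¹(galRange L)` (twin of `localResOverOfEmb_resH1Hom_eq_zero`).

THEOREMS ONLY (no definition, no named fact, no `sorry`).  BSD is NOT proved by this file; nothing is closed by it.

References: [SerreGaloisCohomology1997] I.§2.4, II.§1.1; [MilneADT2006] I.§6 Rem. 6.10; [NeukirchSchmidtWingberg2008] I.§5.
-/

set_option autoImplicit false
set_option linter.dupNamespace false -- `Summit.<P>.<Sub>` repeats `BirchSwinnertonDyer` (D-0017)

noncomputable section

open scoped Classical NumberField.LiesOver

universe u

namespace Summit.BirchSwinnertonDyer.BirchSwinnertonDyer.Theorems.GenusExact.ShaCores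

open WeierstrassCurve NumberField IsDedekindDomain Literature.NumberTheory.EllipticCurves
  Literature.NumberTheory.GaloisRepresentations
  Summit.BirchSwinnertonDyer.Rank1Residual.Additive.LocalTransport

/-! ## §1 Change of embedding conjugates the local restriction (coefficients `E(K̄)`) -/

section EmbChange

variable {F : Type u} [Field F] (W : WeierstrassCurve F) (H : Subgroup (Field.absoluteGaloisGroup F)) [H.Normal]
variable {E : Type u} [Field E] [Algebra F E]

omit [H.Normal] in
/-- The restricted pair `(res_ι : H_ι → H, ι_* : E(F̄) → E(Ē))` is compatible. [cite: SerreGaloisCohomology1997, I.§2.4] -/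
theorem smul_compat_resGalSubgroupOfEmb (ι : AlgebraicClosure F →ₐ[F] AlgebraicClosure E)
    (τ : localSubgroupOfEmb H ι) (P : geomPoints W) :
    pointsMapOfEmb W ι (resGalSubgroupOfEmb H ι τ • P) = τ • pointsMapOfEmb W ι P := by
  rw [Subgroup.smul_def, Subgroup.smul_def, resGalSubgroupOfEmb_apply_coe]
  exact pointsMapOfEmb_smul W ι τ P

/-- **Change of embedding = conjugation** on the local restriction `H¹(H, E(F̄)) → H¹(H_ι, E(Ē))`: for `H` normal,
`ι₀ : F̄ → Ē` and `τ ∈ Γ_F`, the restriction attached to `ι₀ ∘ τ` is `res_{H_{ι₀∘τ} = H_{ι₀}} ∘ (restriction attached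
to ι₀) ∘ conj_τ` — both are the map of the pair `(g ↦ τ⁻¹ (g|_F̄) τ, P ↦ ι₀_* (τ • P))` (`resGalOfEmb_comp`,
`pointsMapOfEmb_comp`).  `E(K̄)`-coefficient twin of `WeierstrassCurve.localResOverOfEmb_comp_apply`.
[cite: SerreGaloisCohomology1997, II.§1.1] -/
theorem resH1Hom_resGalSubgroupOfEmb_comp (ι₀ : AlgebraicClosure F →ₐ[F] AlgebraicClosure E)
    (τ : AlgebraicClosure F ≃ₐ[F] AlgebraicClosure F) (θ : subgroupH1 H (geomPoints W)) :
    resH1Hom (resGalSubgroupOfEmb H (ι₀.comp (τ : AlgebraicClosure F →ₐ[F] AlgebraicClosure F)))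
        (pointsMapOfEmb W (ι₀.comp (τ : AlgebraicClosure F →ₐ[F] AlgebraicClosure F)))
        (smul_compat_resGalSubgroupOfEmb W H _) θ =
      resOfLe (localPoints W E) (localSubgroupOfEmb_comp H ι₀ τ).le
        (resH1Hom (resGalSubgroupOfEmb H ι₀) (pointsMapOfEmb W ι₀) (smul_compat_resGalSubgroupOfEmb W H ι₀)
          (Literature.NumberTheory.EllipticCurves.conjH1 H (geomPoints W) (show Field.absoluteGaloisGroup F from τ) θ)) := by
  rw [Literature.NumberTheory.EllipticCurves.resOfLe, Literature.NumberTheory.EllipticCurves.conjH1, resH1Hom_resH1Hom,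
    resH1Hom_resH1Hom]
  exact DFunLike.congr_fun (resH1Hom_congr
    (ContinuousMonoidHom.ext fun g ↦ Subtype.ext (by
      show resGalOfEmb (ι₀.comp (τ : AlgebraicClosure F →ₐ[F] AlgebraicClosure F))
          (g : Field.absoluteGaloisGroup E) = _
      rw [resGalOfEmb_comp_apply]
      rfl))
    (AddMonoidHom.ext fun P ↦ by
      show pointsMapOfEmb W (ι₀.comp (τ : AlgebraicClosure F →ₐ[F] AlgebraicClosure F)) P = _
      rw [pointsMapOfEmb_comp]
      rfl) _ _) θ

/-- Hence: the local restriction attached to `ι₀ ∘ τ` kills `θ` iff the one attached to `ι₀` kills `conj_τ θ`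
(`res_{H_{ι₀∘τ} = H_{ι₀}}` is injective, `resOfLe_injective_of_ge`). [cite: SerreGaloisCohomology1997, II.§1.1] -/
theorem resH1Hom_resGalSubgroupOfEmb_comp_eq_zero_iff (ι₀ : AlgebraicClosure F →ₐ[F] AlgebraicClosure E)
    (τ : AlgebraicClosure F ≃ₐ[F] AlgebraicClosure F) (θ : subgroupH1 H (geomPoints W)) :
    resH1Hom (resGalSubgroupOfEmb H (ι₀.comp (τ : AlgebraicClosure F →ₐ[F] AlgebraicClosure F)))
        (pointsMapOfEmb W (ι₀.comp (τ : AlgebraicClosure F →ₐ[F] AlgebraicClosure F)))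
        (smul_compat_resGalSubgroupOfEmb W H _) θ = 0 ↔
      resH1Hom (resGalSubgroupOfEmb H ι₀) (pointsMapOfEmb W ι₀) (smul_compat_resGalSubgroupOfEmb W H ι₀)
          (Literature.NumberTheory.EllipticCurves.conjH1 H (geomPoints W) (show Field.absoluteGaloisGroup F from τ) θ) = 0 := by
  rw [resH1Hom_resGalSubgroupOfEmb_comp,
    map_eq_zero_iff _ (resOfLe_injective_of_ge (localPoints W E)
      (localSubgroupOfEmb_comp H ι₀ τ).le (localSubgroupOfEmb_comp H ι₀ τ).ge)]

end EmbChange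

/-! ## §2 The coefficient identity for the model pair `(rangeToResGal, θ⁻¹)` -/

section Coefficients

variable {F : Type u} [Field F] (L : Type u) [Field L] [Algebra F L] (W : WeierstrassCurve F)
variable {E : Type u} [Field E] [Algebra F E] {E' : Type u} [Field E'] [Algebra L E'] [Algebra F E'] [IsScalarTower F L E']
variable (ι : AlgebraicClosure F →ₐ[F] AlgebraicClosure E) (ι₂ : AlgebraicClosure E ≃+* AlgebraicClosure E')
  (ι' : AlgebraicClosure L →ₐ[L] AlgebraicClosure E')
  (hcompat : ∀ z : AlgebraicClosure F, ι' (closureEmb (K := F) L z) = ι₂ (ι z))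

/-- **Coefficient identity** `ψ ∘ (ι')_* ∘ θ = ι_*` on `E(F̄)`, with `θ = localPointsEquivGeomPoints ∘ pointsMap : E(F̄) ≃ E_L(L̄)`
(the coefficient map under `galH1Model`) and `ψ = transportPoints = (ι₂⁻¹)_*` (`ι₂⁻¹ ∘ ι' ∘ ι_L = ι`); the
`E(K̄)`-coefficient twin of `transportPoints_pointsMapOfEmb`. [cite: SerreGaloisCohomology1997, II.§1.1] -/
theorem transportPoints_pointsMapOfEmb_localPointsEquivGeomPoints (P : geomPoints W) :
    transportPoints L ι ι₂ ι' hcompat W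
        (pointsMapOfEmb (W.baseChange L) ι' (localPointsEquivGeomPoints W L (pointsMap W L P))) =
      pointsMapOfEmb W ι P := by
  rw [transportPoints_apply]
  change WeierstrassCurve.Affine.Point.map _ ((pointsCongr W L (AlgebraicClosure E')).symm
    (WeierstrassCurve.Affine.Point.map ι' (pointsCongr W L (AlgebraicClosure L)
      (WeierstrassCurve.Affine.Point.map (closureEmb (K := F) L)
        (show (W.baseChange (AlgebraicClosure F)).toAffine.Point from P))))) =
    WeierstrassCurve.Affine.Point.map ι (show (W.baseChange (AlgebraicClosure F)).toAffine.Point from P)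
  rw [← pointsCongr_map, AddEquiv.symm_apply_apply, WeierstrassCurve.Affine.Point.map_map,
    WeierstrassCurve.Affine.Point.map_map]
  have hF : (((algEquivOfCompat L ι ι₂ ι' hcompat).symm :
        AlgebraicClosure E' →ₐ[F] AlgebraicClosure E).comp (ι'.restrictScalars F)).comp (closureEmb (K := F) L) = ι := by
    apply AlgHom.ext
    intro z
    change ι₂.symm (ι' (closureEmb (K := F) L z)) = ι z
    rw [hcompat, RingEquiv.symm_apply_apply]
  exact congrArg (fun G ↦ WeierstrassCurve.Affine.Point.map G _) hF

end Coefficients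

/-! ## §3 Transfer of a local vanishing along `(ι, ι₂, ι')` -/

section Transfer

variable {F : Type u} [Field F] (L : Type u) [Field L] [Algebra F L] [Algebra.IsAlgebraic F L] [PerfectField L]
  (W : WeierstrassCurve F)
variable {E : Type u} [Field E] [Algebra F E] {E' : Type u} [Field E'] [Algebra L E'] [Algebra F E'] [IsScalarTower F L E']
variable (ι : AlgebraicClosure F →ₐ[F] AlgebraicClosure E) (ι₂ : AlgebraicClosure E ≃+* AlgebraicClosure E')
  (ι' : AlgebraicClosure L →ₐ[L] AlgebraicClosure E')
  (hcompat : ∀ z : AlgebraicClosure F, ι' (closureEmb (K := F) L z) = ι₂ (ι z))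
  (hfix : ∀ h : Field.absoluteGaloisGroup E, resGalOfEmb ι h ∈ galRange (K := F) L → ∀ y : E',
    (show AlgebraicClosure E ≃ₐ[E] AlgebraicClosure E from h)
      (ι₂.symm (algebraMap E' (AlgebraicClosure E') y)) =
        ι₂.symm (algebraMap E' (AlgebraicClosure E') y))
  (ψ : geomPoints (W.baseChange L) →+ geomPoints W)
  (hψ : ∀ (n : galRange (K := F) L) (Q : geomPoints (W.baseChange L)), ψ (rangeToResGal (K := F) L n • Q) = n • ψ Q)
  (hψspec : ∀ P : geomPoints W, ψ (localPointsEquivGeomPoints W L (pointsMap W L P)) = P)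

include hcompat hfix hψspec in
/-- **Transfer of a local vanishing** (`E(K̄)`-coefficient, model-map twin of t42's `localResOverOfEmb_resH1Hom_eq_zero`).
With `N = galRange L`, `H_ι = (res_ι)⁻¹ N ≤ Γ_E`, the transport `T : h ↦ ι₂ h ι₂⁻¹ : H_ι → Γ_{E'}`, `Ψ = (ι₂⁻¹)_*`, and the
model pair `(rangeToResGal, ψ = θ⁻¹)` of `galH1Model`: both composites `H¹(Γ_L, E_L(L̄)) → H¹(H_ι, E(Ē))` — «model
map, then restrict along `(res_ι, ι_*)`» and «restrict at `ι'`, then transport along `(T, Ψ)`» — are induced by the SAME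
compatible pair (`resGal L ∘ res_{ι'} ∘ T = res_ι = resGal L ∘ rangeToResGal ∘ res_ι` and §2), so if `x` dies at `ι'`
then its model class dies at `ι`. [cite: SerreGaloisCohomology1997, I.§2.4 and II.§1.1] -/
theorem resH1Hom_model_eq_zero_of_transport (x : (W.baseChange L).galH1)
    (hx : x ∈ (W.baseChange L).localRestrictionKerOfEmb ι') :
    resH1Hom (resGalSubgroupOfEmb (galRange (K := F) L) ι) (pointsMapOfEmb W ι)
      (smul_compat_resGalSubgroupOfEmb W (galRange (K := F) L) ι)
        (resH1Hom (rangeToResGal (K := F) L) ψ hψ x) = 0 := by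
  -- the transport `T : H_ι → Γ_{E'}`, continuous
  let T : localSubgroupOfEmb (galRange (K := F) L) ι →ₜ* Field.absoluteGaloisGroup E' :=
    { toMonoidHom := transportHom₀ (galRange (K := F) L) ι ι₂ hfix
      continuous_toFun := continuous_transportHom₀ (galRange (K := F) L) ι ι₂ hfix }
  have hTapply : ∀ h, T h = transportHom₀ (galRange (K := F) L) ι ι₂ hfix h := fun _ ↦ rfl
  -- `Ψ` is `T`-equivariant (`transportPoints_smul` with `H' = ⊤`)
  have hθψ : ∀ (h : localSubgroupOfEmb (galRange (K := F) L) ι) (P : localPoints (W.baseChange L) E'),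
      transportPoints L ι ι₂ ι' hcompat W (T h • P) = h • transportPoints L ι ι₂ ι' hcompat W P :=
    fun h P ↦ transportPoints_smul L (galRange (K := F) L) ⊤ (fun _ _ ↦ Subgroup.mem_top _) ι ι₂ ι' hcompat hfix W h P
  -- the group identity `rangeToResGal ∘ res_ι|^N = res_{ι'} ∘ T` (apply the injective `resGal L`)
  have hG : (rangeToResGal (K := F) L).comp (resGalSubgroupOfEmb (galRange (K := F) L) ι) =
      (resGalOfEmb ι').comp T := by
    apply ContinuousMonoidHom.ext
    intro h
    apply resGal_injective (K := F) L
    rw [ContinuousMonoidHom.comp_toFun, ContinuousMonoidHom.comp_toFun, resGal_rangeToResGal,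
      resGalSubgroupOfEmb_apply_coe, hTapply]
    exact (resGal_resGalOfEmb_transportAut L ι ι₂ ι' hcompat (h : Field.absoluteGaloisGroup E) (hfix h h.2)).symm
  -- the coefficient identity `ι_* ∘ ψ = Ψ ∘ ι'_*` on `E_L(L̄)` (every point is `θ P`)
  have hM : (pointsMapOfEmb W ι).comp ψ = (transportPoints L ι ι₂ ι' hcompat W).comp (pointsMapOfEmb (W.baseChange L) ι') := by
    refine AddMonoidHom.ext fun Q ↦ ?_
    obtain ⟨P₀, rfl⟩ := (localPointsEquivGeomPoints W L).surjective Q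
    obtain ⟨P, rfl⟩ := (pointsMapOfEmb_bijective L W (closureEmb (K := F) L)).2 P₀
    rw [AddMonoidHom.comp_apply, AddMonoidHom.comp_apply]
    change pointsMapOfEmb W ι (ψ (localPointsEquivGeomPoints W L (pointsMap W L P))) =
      transportPoints L ι ι₂ ι' hcompat W
        (pointsMapOfEmb (W.baseChange L) ι' (localPointsEquivGeomPoints W L (pointsMap W L P)))
    rw [transportPoints_pointsMapOfEmb_localPointsEquivGeomPoints L W ι ι₂ ι' hcompat P, hψspec]
  -- both composites are `resH1Hom` of the same pair
  have key : ∀ y : (W.baseChange L).galH1,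
      resH1Hom (resGalSubgroupOfEmb (galRange (K := F) L) ι) (pointsMapOfEmb W ι)
          (smul_compat_resGalSubgroupOfEmb W (galRange (K := F) L) ι) (resH1Hom (rangeToResGal (K := F) L) ψ hψ y) =
        resH1Hom T (transportPoints L ι ι₂ ι' hcompat W) hθψ
          (resH1Hom (resGalOfEmb ι') (pointsMapOfEmb (W.baseChange L) ι') (pointsMapOfEmb_smul (W.baseChange L) ι') y) := by
    intro y
    rw [resH1Hom_resH1Hom, resH1Hom_resH1Hom]
    exact DFunLike.congr_fun (resH1Hom_congr hG hM _ _) y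
  have hx0 : resH1Hom (resGalOfEmb ι') (pointsMapOfEmb (W.baseChange L) ι') (pointsMapOfEmb_smul (W.baseChange L) ι') x = 0 := by
    rw [WeierstrassCurve.localRestrictionKerOfEmb, resKer_eq_ker, AddMonoidHom.mem_ker] at hx
    exact hx
  rw [key x, hx0, map_zero]

end Transfer

end Summit.BirchSwinnertonDyer.BirchSwinnertonDyer.Theorems.GenusExact.ShaCores

end
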